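import Summits.HodgeConjecture.HodgeConjecture.Theorems.LimitExtensionHypersurfacesSufficeOfLE
import Summits.HodgeConjecture.HodgeConjecture.Theorems.LimitExtensionMiddleDivisorSupportSuffices
import Summits.HodgeConjecture.HodgeConjecture.Theorems.LimitExtensionSpecialisationOfAlgebraicity
import Literature.AlgebraicGeometry.HodgeTheory.GysinKernelSplit
import Literature.AlgebraicGeometry.HodgeTheory.HodgeRiemannPolarizability
import Literature.AlgebraicGeometry.HodgeTheory.ComplexConjugationHolds
import Literature.AlgebraicGeometry.HodgeTheory.PencilStepBelowMiddle
import Literature.NumberTheory.Transcendental.DeRhamTheoremMultiplicative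

/-!
# Route LimitExtension — `Assembly` (item stmt-HodgeConjecture-10868): the item on NAMED leaves

The assembly item of route `LimitExtension` is
`Assembly := HodgeModels (inline) → LimitExtensionMid → HypersurfaceHodge → HodgeConjecture`,
the planner's composition `fun m a b ↦ h₈ m (h₇ a b)` of its two registered deps
`h₇ : PullbackGlue` (stmt-HodgeConjecture-2999 = the specialisation lemma stmt-HodgeConjecture-2998
plus one line, the tree's `limitExtension_pullbackGlue_of_specialisation`) and
`h₈ : MiddleDivisorSupportSuffices` (stmt-HodgeConjecture-10865; the composition itself is the
tree's `limitExtension_assembly_of`).  The second dep is the tree's assembly induction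
`middleDivisorSupportSuffices_of_facts` fed by THREE NAMED Literature facts (as in
`middleDivisorSupportSuffices_of_leaves` of `LimitExtensionMiddleDivisorSupportSufficesOfPencilStep`,
re-derived here in three lines to keep this file's import closure on built modules):

* `Deligne1974_ker_pullback_eq_ker_pullback_resolution` — Deligne, *Hodge III*, Prop. 8.2.7 (the
  weight argument `Ker(Hⁿ(Z) → Hⁿ(Z̃)) = W_{n-1}`; ⟹ Cor. 8.2.8 by
  `Deligne1974_ker_restrictCompl_eq_iSup_range_complexGysin_holds_of`);
* `smoothProjective_hodgeStructure_isPolarizable` — Hodge–Riemann with the Lefschetz decomposition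
  (Voisin I, Thm. 6.32 / 6.25; ⟹ Voisin 2025 Cor. 2.12, Hodge classes lift along Gysin sums, by
  `Voisin2025_hodgeClass_lift_complexGysin_holds_of` with the theorems `exists_isReal_hodgeModel_holds`
  and `exists_deRhamIsoFamily_holds`);
* `deCataldoMigliorini2009_mem_algebraicClasses_of_two_mul_le` — the Lefschetz-pencil step below
  the middle (de Cataldo–Migliorini 2009, proof of Prop. 4.5 = Thomas 2005, proof of Prop. 2), which
  supplies the hypothesis `hPen` of the induction (its second antecedent is not even needed).

This file records the resulting residue of the ASSEMBLY item in single declarations, so that the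
gate's debt accounting sees exactly which named facts the item waits for:

* `limitExtension_middleDivisorSupportSuffices_of_namedLeaves` — dep stmt-HodgeConjecture-10865
  from the three named facts (CONDITIONAL on them);
* `limitExtension_assembly_of_pullbackGlue_of_namedLeaves` — `Assembly` from its registered dep
  `PullbackGlue` and the three named facts;
* `limitExtension_assembly_of_namedLeaves` — `Assembly` from the three named facts and the route's
  specialisation lemma `SpecialisationOfAlgebraicity` (stmt-HodgeConjecture-2998);
* `limitExtension_assembly_of_spread_of_limit_of_namedLeaves` — the same with the specialisation
  lemma replaced by the two classical-topology statements `spread` (spreading of algebraic supports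
  along the family: relative Hilbert/Chow schemes, Fulton 1998 §10.1/§20.3) and `limit` (upper
  semicontinuity of supports at the degeneration into the smooth locus, local Ehresmann) to which
  the tree's `specialisationOfAlgebraicity_of_spread_of_limit` reduces it — i.e. the COMPLETE
  current residue of the item: three named facts and two explicit Hodge-free statements.

CLOSING RECIPE (once the leaves are theorems `h827_holds`, `hpol_holds`, `hpen_holds` and
stmt-HodgeConjecture-2998 is `specialisationOfAlgebraicity_proof`):
`theorem limitExtension_assembly_proof : Assembly :=
  limitExtension_assembly_of_namedLeaves h827_holds hpol_holds hpen_holds specialisationOfAlgebraicity_proof`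
(`--workitem stmt-HodgeConjecture-10868`), then `ledger workitem release … --by` it.

## References

* [Thomas2005Nodes] R. P. Thomas, Nodes and the Hodge conjecture, J. Algebraic Geom. 14 (2005),
  Prop. 2 and its proof.
* [DecataldoMigliorini2009] M. A. de Cataldo, L. Migliorini, §4, Prop. 4.5 (arXiv:0711.1307v1).
* [DeligneHodgeIII1974] P. Deligne, Théorie de Hodge III, Publ. Math. IHÉS 44 (1974), Prop. 8.2.7,
  Cor. 8.2.8.
* [VoisinHodgeI2002] C. Voisin, Hodge Theory and Complex Algebraic Geometry I, Thm. 6.25, 6.32.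
* [Voisin2025] C. Voisin, J. Open Math. Probl. 1 (2025), Cor. 2.12.
* [Fulton1998] W. Fulton, Intersection Theory, §10.1, §19.1, §20.3.
-/

-- `Summit.HodgeConjecture.HodgeConjecture.Theorems` is the mandated namespace (single-conjunct summit:
-- Sub = Summit), which `linter.dupNamespace` flags on every declaration; the lakefile turns the
-- linter off tree-wide (weak option), restated here so stand-alone elaboration is warning-free too.
set_option linter.dupNamespace false

noncomputable section

namespace Summit.HodgeConjecture.HodgeConjecture.Theorems

open Summit.HodgeConjecture.HodgeConjecture.Theses.LimitExtension
open scoped Manifold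
open CategoryTheory AlgebraicGeometry
open Literature.AlgebraicGeometry Literature.AlgebraicGeometry.HodgeTheory
  Literature.AlgebraicGeometry.Motives

/-- **Dep stmt-HodgeConjecture-10865 (`MiddleDivisorSupportSuffices`) from three NAMED facts**:
Deligne *Hodge III* Prop. 8.2.7 (`h827`, ⟹ Cor. 8.2.8), the polarizability of the Hodge structure
of a smooth projective variety (`hpol`, Hodge–Riemann, ⟹ Voisin 2025 Cor. 2.12 with the theorems
`exists_isReal_hodgeModel_holds`, `exists_deRhamIsoFamily_holds`) and the Lefschetz-pencil step below
the middle (`hpen`), feeding the tree's assembly induction `middleDivisorSupportSuffices_of_facts`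
(whose pencil hypothesis drops its unused second antecedent).  CONDITIONAL on the three facts; the
same term as the tree's `middleDivisorSupportSuffices_of_leaves`.
[cite: Thomas2005Nodes, Prop. 2 (proof)] [cite: DeligneHodgeIII1974, Prop. 8.2.7 and Cor. 8.2.8]
[cite: Voisin2025, Cor. 2.12] [cite: DecataldoMigliorini2009, §4 Prop. 4.5 (proof)] -/
theorem limitExtension_middleDivisorSupportSuffices_of_namedLeaves
    (h827 : Deligne1974_ker_pullback_eq_ker_pullback_resolution)
    (hpol : smoothProjective_hodgeStructure_isPolarizable)
    (hpen : deCataldoMigliorini2009_mem_algebraicClasses_of_two_mul_le) :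
    MiddleDivisorSupportSuffices :=
  middleDivisorSupportSuffices_of_facts
    (Deligne1974_ker_restrictCompl_eq_iSup_range_complexGysin_holds_of h827)
    (Voisin2025_hodgeClass_lift_complexGysin_holds_of exists_isReal_hodgeModel_holds
      (fun E _ _ _ ↦ Literature.NumberTheory.Transcendental.exists_deRhamIsoFamily_holds E) hpol)
    (fun _m p _hp hpm hHC _ _X hX c hc hH ↦ hpen hX hHC p c hpm hc hH)

/-- **`Assembly` (item stmt-HodgeConjecture-10868) from its registered dep `PullbackGlue`
(stmt-HodgeConjecture-2999) and the three named facts** — the planner's composition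
`fun m a b ↦ h₈ m (h₇ a b)` with `h₈ = limitExtension_middleDivisorSupportSuffices_of_namedLeaves …`.
CONDITIONAL on the three facts.
[cite: Thomas2005Nodes, Prop. 2 (proof)] [cite: DeligneHodgeIII1974, Prop. 8.2.7 and Cor. 8.2.8]
[cite: VoisinHodgeI2002, Thm. 6.32 with Thm. 6.25] [cite: DecataldoMigliorini2009, §4 Prop. 4.5 (proof)] -/
theorem limitExtension_assembly_of_pullbackGlue_of_namedLeaves (h₇ : PullbackGlue)
    (h827 : Deligne1974_ker_pullback_eq_ker_pullback_resolution)
    (hpol : smoothProjective_hodgeStructure_isPolarizable)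
    (hpen : deCataldoMigliorini2009_mem_algebraicClasses_of_two_mul_le) : Assembly :=
  fun hM a b ↦ limitExtension_middleDivisorSupportSuffices_of_namedLeaves h827 hpol hpen hM (h₇ a b)

/-- **`Assembly` from the three named facts and the specialisation lemma**
(`hS : SpecialisationOfAlgebraicity`, item stmt-HodgeConjecture-2998, which yields `PullbackGlue` by
`limitExtension_pullbackGlue_of_specialisation`).  This is the item's closing term once the four
inputs are theorems (module docstring).  CONDITIONAL on the three facts.
[cite: Thomas2005Nodes, Prop. 2 (proof)] [cite: DeligneHodgeIII1974, Prop. 8.2.7 and Cor. 8.2.8]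
[cite: VoisinHodgeI2002, Thm. 6.32 with Thm. 6.25] [cite: DecataldoMigliorini2009, §4 Prop. 4.5 (proof)] -/
theorem limitExtension_assembly_of_namedLeaves
    (h827 : Deligne1974_ker_pullback_eq_ker_pullback_resolution)
    (hpol : smoothProjective_hodgeStructure_isPolarizable)
    (hpen : deCataldoMigliorini2009_mem_algebraicClasses_of_two_mul_le)
    (hS : SpecialisationOfAlgebraicity) : Assembly :=
  limitExtension_assembly_of_pullbackGlue_of_namedLeaves
    (limitExtension_pullbackGlue_of_specialisation hS) h827 hpol hpen

/-- **The complete current residue of the item.**  `Assembly` from the three named facts and the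
two Hodge-free statements to which the tree reduces the specialisation lemma
(`specialisationOfAlgebraicity_of_spread_of_limit`): `spread` — along a flat proper family over a
smooth irreducible curve whose fibres off `t₀` are smooth projective `2k`-folds carrying algebraic
restrictions `B_t` of a global class `B`, ONE Zariski-closed `𝒵 ⊆ W`, of codimension `≥ k` in the
special fibre, off whose slices all the `B_t` (`t ≠ t₀`) die (relative Hilbert/Chow schemes,
countability, flat limits of supports; Fulton 1998 §10.1, §20.3) — and `limit` — if the `B_t` die
off the slices `𝒵_t` for `t ≠ t₀`, the restriction of `B` to a smooth open piece `V` of the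
special fibre dies off `𝒵 ∩ V` (local Ehresmann off the special fibre, vanishing detected on
compacta).  CONDITIONAL on the three facts; `spread` and `limit` are explicit hypotheses.
[cite: Fulton1998, §10.1, §19.1 and §20.3] [cite: Thomas2005Nodes, Prop. 2 (proof)]
[cite: DeligneHodgeIII1974, Prop. 8.2.7 and Cor. 8.2.8] [cite: DecataldoMigliorini2009, §4 Prop. 4.5 (proof)] -/
theorem limitExtension_assembly_of_spread_of_limit_of_namedLeaves
    (h827 : Deligne1974_ker_pullback_eq_ker_pullback_resolution)
    (hpol : smoothProjective_hodgeStructure_isPolarizable)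
    (hpen : deCataldoMigliorini2009_mem_algebraicClasses_of_two_mul_le)
    (spread : ∀ ⦃k : ℕ⦄ ⦃T W : SchemeOver ℂ⦄ (f : W ⟶ T) (t₀ : ComplexPoints T)
      (B : complexBetti W (2 * k)),
      SmoothOfRelativeDimension 1 T.hom → IrreducibleSpace T.left → Flat f.left →
      IsProper f.left →
      (∀ t : ComplexPoints T, t ≠ t₀ → IsSmoothProjective (2 * k) (fiberOver f t) ∧
        complexBetti.map (fiberι f t) (2 * k) B ∈ algebraicClasses (fiberOver f t) k) →
      ∃ 𝒵 : Set W.left, IsClosed 𝒵 ∧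
        (∀ m : ↥(fiberOver f t₀).left, (fiberι f t₀).left.base m ∈ 𝒵 →
          (k : ℕ∞) ≤ Order.coheight m) ∧
        ∀ t : ComplexPoints T, t ≠ t₀ →
          complexBetti.restrictCompl (fiberOver f t) ((fiberι f t).left.base ⁻¹' 𝒵) (2 * k)
            (complexBetti.map (fiberι f t) (2 * k) B) = 0)
    (limit : ∀ ⦃i n : ℕ⦄ ⦃V T W : SchemeOver ℂ⦄ (f : W ⟶ T) (t₀ : ComplexPoints T)
      (j : V ⟶ fiberOver f t₀) (𝒵 : Set W.left) (B : complexBetti W i),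
      SmoothOfRelativeDimension n V.hom → SmoothOfRelativeDimension 1 T.hom →
      IrreducibleSpace T.left → Flat f.left → IsProper f.left → IsOpenImmersion j.left →
      IsClosed 𝒵 →
      (∀ t : ComplexPoints T, t ≠ t₀ →
        complexBetti.restrictCompl (fiberOver f t) ((fiberι f t).left.base ⁻¹' 𝒵) i
          (complexBetti.map (fiberι f t) i B) = 0) →
      complexBetti.restrictCompl V ((j ≫ fiberι f t₀).left.base ⁻¹' 𝒵) i
        (complexBetti.map (j ≫ fiberι f t₀) i B) = 0) :
    Assembly :=
  limitExtension_assembly_of_namedLeaves h827 hpol hpen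
    (specialisationOfAlgebraicity_of_spread_of_limit spread limit)

end Summit.HodgeConjecture.HodgeConjecture.Theorems

end
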